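import Summits.Ventures.QEC.CircuitDistance.ETowerZeros345DX
import HarnessLib

/-!
# P3-PORT STEP 2 (E-fold tower), sector X: ZERO-FIBRE COMPLETENESS CERTIFICATES, file 4 of 9 (PORT-SPEC N3; `goodFibK_zero` hypothesis `hD`)
(cell `qec`, experiment CDX; emitter idea-1 g5 `zerocert/emit_zeros2.py`; W = 10, half-words of weight ≤ 5)

Brute force anchored at the first slot `a = b·ls·ms` of each block `b < 5`: `zloopk M ok (M a) (2^a) (a+1) ns = true` says every
`k` further slots `ns > i₁ > … > i_k > a` with `M a ⊕ M i₁ ⊕ … ⊕ M i_k = 0` give a word matched in the D-list (`ok = matchedB ls ms 5 DX`);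
`zbandk … ilo ihi` = the same with the outer slot restricted to `[ilo, ihi)` (bands glued by `ETowerZeroCert.zspec_of_bands`).
4 theorems, 388275 leaves, ≈ 163 s predicted at 420 µs/leaf.  `decide +kernel` only; nothing here asserts a value of `d_circ`.
-/

set_option maxRecDepth 100000
set_option exponentiation.threshold 1024
set_option linter.unusedVariables false

namespace Summit.Ventures.QEC.CircuitDistance.ETower.Sec345X.Zeros

open Summit.Ventures.QEC.Census Summit.Ventures.QEC.Census.Fold Summit.Ventures.QEC.CircuitDistance.ETower

set_option maxHeartbeats 400000000 in
/-- level B, anchor slot 0 (block 0), 4 further slots from [1,90), outer slot in [84,85): 91881 leaves ≈ 39 s. -/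
theorem zcB_b0_k4_i84_85 : zbandK 4 (tab Sec345X.TFB 42) (matchedM 6 3 5 Sec345X.Zeros.DB) (tab Sec345X.TFB 42 0) (2 ^ 0) 1 84 85 = true := by
  decide +kernel

set_option maxHeartbeats 400000000 in
/-- level B, anchor slot 0 (block 0), 4 further slots from [1,90), outer slot in [85,86): 95284 leaves ≈ 40 s. -/
theorem zcB_b0_k4_i85_86 : zbandK 4 (tab Sec345X.TFB 42) (matchedM 6 3 5 Sec345X.Zeros.DB) (tab Sec345X.TFB 42 0) (2 ^ 0) 1 85 86 = true := by
  decide +kernel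

set_option maxHeartbeats 400000000 in
/-- level B, anchor slot 0 (block 0), 4 further slots from [1,90), outer slot in [86,87): 98770 leaves ≈ 41 s. -/
theorem zcB_b0_k4_i86_87 : zbandK 4 (tab Sec345X.TFB 42) (matchedM 6 3 5 Sec345X.Zeros.DB) (tab Sec345X.TFB 42 0) (2 ^ 0) 1 86 87 = true := by
  decide +kernel

set_option maxHeartbeats 400000000 in
/-- level B, anchor slot 0 (block 0), 4 further slots from [1,90), outer slot in [87,88): 102340 leaves ≈ 43 s. -/
theorem zcB_b0_k4_i87_88 : zbandK 4 (tab Sec345X.TFB 42) (matchedM 6 3 5 Sec345X.Zeros.DB) (tab Sec345X.TFB 42 0) (2 ^ 0) 1 87 88 = true := by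
  decide +kernel

end Summit.Ventures.QEC.CircuitDistance.ETower.Sec345X.Zeros
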